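import Literature.Topology.FourManifolds.CappellShanesonWang
import Literature.AlgebraicTopology.SingularHomology.LocalHomologyVanishing
import Literature.AlgebraicTopology.SingularHomology.FundamentalClassProofs
import HarnessLib

/-!
# The homology of the punctured 3-torus: reduction of
`Literature.Topology.FourManifolds.isIso_singularHomology_map_puncturedThreeTorusIncl` to the orientability of `T³`

`Literature.Topology.FourManifolds.CappellShanesonWang` states as a **named fact** (D-0014)
`Literature.Topology.FourManifolds.isIso_singularHomology_map_puncturedThreeTorusIncl`: the inclusion `T³ ∖ {1} ↪ T³` induces
isomorphisms on `H₁(−; ℤ)` and `H₂(−; ℤ)` (one of the two torus inputs of the homological half of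
Cappell–Shaneson, Ann. of Math. 104 (1976), §2). Its docstring describes the mechanism: the long
exact sequence of the pair `(T³, T³ ∖ 1)`, the vanishing of the local homology groups
`Hₖ(T³ | 1) ≅ Hₖ(ℝ³ | 0)` for `k ≠ 3` (excision, A. Hatcher, *Algebraic Topology*, CUP 2002,
Thm. 2.20 and §3.3 p. 231), and the surjectivity of `H₃(T³) → H₃(T³ | 1) ≅ ℤ` for the closed
connected orientable 3-manifold `T³` (Hatcher Thm. 3.26(a)).

Here everything except the last input is **proved**:

* `Literature.threeTorusChart x : T³ ⇀ ℝ³` — a chart of `T³ = 𝕊¹ × 𝕊¹ × 𝕊¹` at `x` with values in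
  `ℝ³ = (Fin 3 → ℝ)` (the product chart re-targeted along a linear homeomorphism
  `𝔼¹ × 𝔼¹ × 𝔼¹ ≃ₜ ℝ³`);
* `Literature.Topology.FourManifolds.isZero_localHomology_threeTorus` — `Hₖ(T³ | x; M) = 0` for `k ≠ 3` (from
  `Literature.AlgebraicTopology.SingularHomology.isZero_localHomology_of_chart` of `…LocalHomologyVanishing`, i.e. excision and the local
  homology of `ℝ³`, all proved);
* `Literature.Topology.FourManifolds.epi_singularHomology_map_puncturedThreeTorusIncl`,
  `Literature.Topology.FourManifolds.mono_singularHomology_map_puncturedThreeTorusIncl_one`,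
  `Literature.Topology.FourManifolds.isIso_singularHomology_map_puncturedThreeTorusIncl_one` — `Hₖ(T³ ∖ 1) → Hₖ(T³)` is onto
  for `k = 1, 2` and an isomorphism for `k = 1` (long exact sequence of the pair, proved in
  `…RelativeHomology`);
* the remaining input split into a `T³`-specific **named fact**
  `Literature.Topology.FourManifolds.isOrientableOver_int_threeTorus` — `T³` is `ℤ`-orientable (Lee, *Introduction to Smooth
  Manifolds*, 2nd ed., Example 15.18: tori are parallelizable, hence orientable; a smooth
  orientation induces a homological one, Bredon, *Topology and Geometry*, §VI.7, the bridge
  recorded in the tree as `Literature.Topology.FourManifolds.SmoothOrientation.existsUnique_isCompatible`) — and the general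
  named fact `Literature.AlgebraicTopology.SingularHomology.existsUnique_isFundamentalClass` of `…FundamentalClass` (Hatcher Thm. 3.26(a) /
  Lemma 3.27(a)); from the two, `Literature.Topology.FourManifolds.isIso_toLocal_threeTorus_of_isOrientable`:
  `H₃(T³; ℤ) → H₃(T³ | x; ℤ)` is an isomorphism (onto by the fundamental class, injective by
  Thm. 3.26(b), proved in `…FundamentalClassProofs`), `T³` being a compact connected 3-manifold
  (`Literature.Topology.FourManifolds.threeTorusChartedSpaceFinThree`, a `ChartedSpace (𝔼 3) T³` structure kept as a `def`);
* `Literature.Topology.FourManifolds.isIso_singularHomology_map_puncturedThreeTorusIncl_of_epi_toLocal`,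
  `Literature.Topology.FourManifolds.isIso_singularHomology_map_puncturedThreeTorusIncl_of_isOrientable` — **the named fact
  `isIso_singularHomology_map_puncturedThreeTorusIncl` follows** from the surjectivity of
  `H₃(T³) → H₃(T³ | 1)`, hence from the two named facts above.

## References

* S. E. Cappell, J. L. Shaneson, *Some new four-manifolds*, Ann. of Math. 104 (1976), §2
  [CappellShanesonAnnals1976].
* A. Hatcher, *Algebraic Topology*, CUP 2002, §2.1 Thm. 2.13 ff., Thm. 2.20; §3.3 p. 231,
  Thm. 3.26(a) (p. 236) [HatcherAT2002].
* J. M. Lee, *Introduction to Smooth Manifolds*, 2nd ed., GTM 218, Springer 2013, Prop. 15.17 and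
  Example 15.18 (pp. 383–384) [LeeSmoothManifolds2013].
* G. E. Bredon, *Topology and Geometry*, GTM 139, Springer 1993, §VI.7 [Bredon1993].
-/

noncomputable section

open Set Function CategoryTheory Limits Topology
open scoped Manifold ContDiff Topology

namespace Literature.Topology.FourManifolds

/-- Local notation: `𝔼 n` is the model Euclidean space `EuclideanSpace ℝ (Fin n)`. -/
local notation "𝔼 " n:arg => EuclideanSpace ℝ (Fin n)

/-! ### A chart of `T³` with values in `ℝ³` -/

section Chart

/-- The model space `𝔼¹ × (𝔼¹ × 𝔼¹)` of the product charted space `T³ = 𝕊¹ × 𝕊¹ × 𝕊¹` is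
linearly homeomorphic to `ℝ³ = (Fin 3 → ℝ)` (both are `3`-dimensional real vector spaces). [folklore] -/
def threeTorusModelHomeomorph : ((𝔼 1) × ((𝔼 1) × (𝔼 1))) ≃ₜ Literature.AlgebraicTopology.SingularHomology.RVec 3 :=
  (ContinuousLinearEquiv.ofFinrankEq (𝕜 := ℝ) (by
    rw [Module.finrank_prod, Module.finrank_prod, finrank_euclideanSpace_fin,
      Module.finrank_fintype_fun_eq_card, Fintype.card_fin])).toHomeomorph

/-- A chart of the 3-torus at `x` with values in `ℝ³ = (Fin 3 → ℝ)`: the product chart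
`chartAt x : T³ ⇀ 𝔼¹ × (𝔼¹ × 𝔼¹)` followed by `Literature.Topology.FourManifolds.threeTorusModelHomeomorph`. [folklore] -/
def threeTorusChart (x : ThreeTorus) : OpenPartialHomeomorph ThreeTorus (Literature.AlgebraicTopology.SingularHomology.RVec 3) :=
  (chartAt (ModelProd (𝔼 1) (ModelProd (𝔼 1) (𝔼 1))) x).transHomeomorph threeTorusModelHomeomorph

/-- `x` lies in the source of its chart `threeTorusChart x`. [folklore] -/
lemma mem_threeTorusChart_source (x : ThreeTorus) : x ∈ (threeTorusChart x).source := by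
  rw [threeTorusChart, OpenPartialHomeomorph.transHomeomorph_source]
  exact mem_chart_source _ x

end Chart

/-! ### Local homology of `T³` and the long exact sequence of `(T³, T³ ∖ 1)` -/

section Homology

variable (R : Type) [CommRing R] (M : Type) [AddCommGroup M] [Module R M]

/-- **`Hₖ(T³ | x; M) = 0` for `k ≠ 3`** (Hatcher 2002, §3.3, p. 231: `Hₖ(M | x) ≅ Hₖ(ℝ³ | 0) ≅
H̃ₖ₋₁(S²)`; here from `Literature.AlgebraicTopology.SingularHomology.isZero_localHomology_of_chart`, i.e. excision into the chart
`threeTorusChart x` and the local homology of `ℝ³`, all proved). [cite: HatcherAT2002, §3.3 p. 231] -/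
theorem isZero_localHomology_threeTorus (x : ThreeTorus) {k : ℕ} (hk : k ≠ 3) :
    IsZero (Literature.AlgebraicTopology.SingularHomology.localHomology R M ThreeTorus x k) :=
  Literature.AlgebraicTopology.SingularHomology.isZero_localHomology_of_chart R M (threeTorusChart x) (mem_threeTorusChart_source x) hk

/-- The inclusion `T³ ∖ {1} ↪ T³` of `CappellShanesonWang.lean` is the subspace inclusion
`subsetIncl {1}ᶜ`. [folklore] -/
lemma puncturedThreeTorusIncl_eq : puncturedThreeTorusIncl = Literature.AlgebraicTopology.SingularHomology.subsetIncl puncturedThreeTorus := rfl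

/-- **`Hₖ(T³ ∖ 1; M) → Hₖ(T³; M)` is onto for `k ≠ 3`** (in particular for `k = 1, 2`): in the exact
sequence `Hₖ(T³ ∖ 1) → Hₖ(T³) → Hₖ(T³ | 1)` the last group vanishes (Hatcher 2002, Thm. 2.13 ff.
and §3.3 p. 231). [cite: HatcherAT2002, §3.3 p. 231] -/
theorem epi_singularHomology_map_puncturedThreeTorusIncl {k : ℕ} (hk : k ≠ 3) :
    Epi (Literature.AlgebraicTopology.SingularHomology.singularHomology.map R M puncturedThreeTorusIncl k) := by
  rw [puncturedThreeTorusIncl_eq]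
  refine (Literature.AlgebraicTopology.SingularHomology.relativeSingularHomology.exact_map_ofAbsolute R M (X := ThreeTorus)
    puncturedThreeTorus k).epi_f ?_
  exact (isZero_localHomology_threeTorus R M 1 hk).eq_of_tgt _ _

/-- **`H₁(T³ ∖ 1; M) → H₁(T³; M)` is injective**: in the exact sequence
`H₂(T³ | 1) → H₁(T³ ∖ 1) → H₁(T³)` the first group vanishes (Hatcher 2002, Thm. 2.13 ff. and
§3.3 p. 231). [cite: HatcherAT2002, §3.3 p. 231] -/
theorem mono_singularHomology_map_puncturedThreeTorusIncl_one :
    Mono (Literature.AlgebraicTopology.SingularHomology.singularHomology.map R M puncturedThreeTorusIncl 1) := by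
  rw [puncturedThreeTorusIncl_eq]
  refine (Literature.AlgebraicTopology.SingularHomology.relativeSingularHomology.exact_δ_map R M (X := ThreeTorus) puncturedThreeTorus 1).mono_g ?_
  exact (isZero_localHomology_threeTorus R M 1 (by norm_num)).eq_of_src _ _

/-- **`H₁(T³ ∖ 1; M) ≅ H₁(T³; M)`** by the inclusion (Hatcher 2002, §2.1/§3.3), unconditionally.
[cite: HatcherAT2002, §3.3 p. 231] -/
theorem isIso_singularHomology_map_puncturedThreeTorusIncl_one :
    IsIso (Literature.AlgebraicTopology.SingularHomology.singularHomology.map R M puncturedThreeTorusIncl 1) := by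
  haveI := epi_singularHomology_map_puncturedThreeTorusIncl R M (k := 1) (by norm_num)
  haveI := mono_singularHomology_map_puncturedThreeTorusIncl_one R M
  exact isIso_of_mono_of_epi _

/-- **`H₂(T³ ∖ 1; M) → H₂(T³; M)` is injective, granted that `H₃(T³; M) → H₃(T³ | 1; M)` is onto**:
in the exact sequence `H₃(T³) → H₃(T³ | 1) →∂ H₂(T³ ∖ 1) → H₂(T³)`, `∂ = 0` (Hatcher 2002,
Thm. 2.13 ff.). [cite: HatcherAT2002, §2.1 Thm. 2.16] -/
theorem mono_singularHomology_map_puncturedThreeTorusIncl_two_of_epi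
    (h : Epi (Literature.AlgebraicTopology.SingularHomology.singularHomology.toLocal R M (1 : ThreeTorus) 3)) :
    Mono (Literature.AlgebraicTopology.SingularHomology.singularHomology.map R M puncturedThreeTorusIncl 2) := by
  rw [puncturedThreeTorusIncl_eq]
  refine (Literature.AlgebraicTopology.SingularHomology.relativeSingularHomology.exact_δ_map R M (X := ThreeTorus) puncturedThreeTorus 2).mono_g ?_
  change Literature.AlgebraicTopology.SingularHomology.relativeSingularHomology.δ R M ThreeTorus puncturedThreeTorus 2 = 0
  haveI : Epi (Literature.AlgebraicTopology.SingularHomology.relativeSingularHomology.ofAbsolute R M ThreeTorus puncturedThreeTorus 3) := h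
  rw [← cancel_epi (Literature.AlgebraicTopology.SingularHomology.relativeSingularHomology.ofAbsolute R M ThreeTorus puncturedThreeTorus 3),
    Literature.AlgebraicTopology.SingularHomology.relativeSingularHomology.ofAbsolute_comp_δ, comp_zero]

end Homology

/-! ### The orientability of `T³` (named fact) and the reduction -/

section Reduction

/-- The model space `𝔼¹ × (𝔼¹ × 𝔼¹)` of `T³` is linearly homeomorphic to `𝔼³`. [folklore] -/
def threeTorusModelHomeomorphEuclidean : ((𝔼 1) × ((𝔼 1) × (𝔼 1))) ≃ₜ 𝔼 3 :=
  (ContinuousLinearEquiv.ofFinrankEq (𝕜 := ℝ) (by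
    rw [Module.finrank_prod, Module.finrank_prod, finrank_euclideanSpace_fin,
      finrank_euclideanSpace_fin])).toHomeomorph

/-- **`T³` as a topological 3-manifold in the sense of the tree's singular-homology files**
(`[ChartedSpace (EuclideanSpace ℝ (Fin 3)) T³]`): the product charted space structure of
`T³ = 𝕊¹ × 𝕊¹ × 𝕊¹` over `𝔼¹ × (𝔼¹ × 𝔼¹)` composed with the single chart
`𝔼¹ × (𝔼¹ × 𝔼¹) ≃ₜ 𝔼³`. A `def`, not an instance (Mathlib's product structure over `ModelProd`
stays the canonical one); used as a local instance. [folklore] -/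
@[reducible] def threeTorusChartedSpaceFinThree : ChartedSpace (𝔼 3) ThreeTorus :=
  letI : ChartedSpace (𝔼 3) (ModelProd (𝔼 1) (ModelProd (𝔼 1) (𝔼 1))) :=
    (threeTorusModelHomeomorphEuclidean.toOpenPartialHomeomorph :
        OpenPartialHomeomorph (ModelProd (𝔼 1) (ModelProd (𝔼 1) (𝔼 1))) (𝔼 3)).singletonChartedSpace
      (by simp)
  ChartedSpace.comp (𝔼 3) (ModelProd (𝔼 1) (ModelProd (𝔼 1) (𝔼 1))) ThreeTorus

/-- **The 3-torus is orientable** (named fact, not proved here): `T³ = 𝕊¹ × 𝕊¹ × 𝕊¹` admits a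
homological `ℤ`-orientation in dimension `3` in the sense of Hatcher, *Algebraic Topology* (2002),
§3.3, p. 234 (`Literature.HomologicalOrientation ℤ T³ 3`, i.e. `Literature.IsOrientableOver ℤ T³ 3`). Source:
the torus is parallelizable, hence an orientable smooth manifold (Lee, *Introduction to Smooth
Manifolds*, 2nd ed., Prop. 15.17 and Example 15.18, pp. 383–384: "the `n`-torus `𝕋ⁿ` … are all
orientable"), and a smooth orientation determines a homological `ℤ`-orientation (Bredon,
*Topology and Geometry*, §VI.7; in the tree the named fact
`Literature.Topology.FourManifolds.SmoothOrientation.existsUnique_isCompatible` of `SmoothHomologicalOrientation.lean`).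
[cite: LeeSmoothManifolds2013, Example 15.18] -/
def isOrientableOver_int_threeTorus : Prop :=
  Literature.AlgebraicTopology.SingularHomology.IsOrientableOver ℤ ThreeTorus 3

/-- **`H₃(T³; ℤ) → H₃(T³ | x; ℤ)` is an isomorphism for every `x`**, GIVEN the orientability of
`T³` (`isOrientableOver_int_threeTorus`) and the existence of fundamental classes for closed
oriented manifolds (the named fact `Literature.AlgebraicTopology.SingularHomology.existsUnique_isFundamentalClass` of `…FundamentalClass`,
Hatcher Thm. 3.26(a) / Lemma 3.27(a), here only for `T³`): the fundamental class maps to the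
generator `μₓ`, so the map is onto, and it is injective by Hatcher Thm. 3.26(b), proved in
`…FundamentalClassProofs` (`toLocal_injective_of_connectedSpace_holds`) — `T³` is compact,
Hausdorff, connected and a topological 3-manifold (`threeTorusChartedSpaceFinThree`).
[cite: HatcherAT2002, Thm. 3.26(a)] -/
theorem isIso_toLocal_threeTorus_of_isOrientable (hO : isOrientableOver_int_threeTorus)
    (hF : @Literature.AlgebraicTopology.SingularHomology.existsUnique_isFundamentalClass ℤ _ ThreeTorus _ 3) (x : ThreeTorus) :
    IsIso (Literature.AlgebraicTopology.SingularHomology.singularHomology.toLocal ℤ ℤ x 3) := by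
  letI := threeTorusChartedSpaceFinThree
  obtain ⟨μ⟩ := hO
  obtain ⟨c, hc, -⟩ := hF μ
  have hinj := Literature.AlgebraicTopology.SingularHomology.singularHomology.toLocal_injective_of_connectedSpace_holds ℤ ℤ (X := ThreeTorus) 3 x
  have hsurj : Function.Surjective (Literature.AlgebraicTopology.SingularHomology.singularHomology.toLocal ℤ ℤ x 3) := by
    obtain ⟨e, he⟩ := μ.isGenerator x
    intro y
    refine ⟨(e y) • c, ?_⟩
    have h1 : (Literature.AlgebraicTopology.SingularHomology.singularHomology.toLocal ℤ ℤ x 3) ((e y) • c) =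
        (e y) • (Literature.AlgebraicTopology.SingularHomology.singularHomology.toLocal ℤ ℤ x 3) c :=
      (Literature.AlgebraicTopology.SingularHomology.singularHomology.toLocal ℤ ℤ x 3).hom.toAddMonoidHom.map_zsmul (e y) c
    rw [h1, hc x]
    apply e.injective
    rw [map_zsmul e, he, zsmul_eq_mul, mul_one, Int.cast_id]
  exact (ConcreteCategory.isIso_iff_bijective _).mpr ⟨hinj, hsurj⟩

/-- **The puncture comparison from the surjectivity of `H₃(T³) → H₃(T³ | 1)`**: if
`H₃(T³; ℤ) → H₃(T³ | 1; ℤ)` is onto then `T³ ∖ {1} ↪ T³` induces isomorphisms on `H₁` and `H₂` with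
integer coefficients, i.e. the named fact `Literature.Topology.FourManifolds.isIso_singularHomology_map_puncturedThreeTorusIncl`
holds (long exact sequence of the pair and `Hₖ(T³ | 1) = 0` for `k ≠ 3`, both proved).
[cite: HatcherAT2002, §3.3 Thm. 3.26 and p. 231] -/
theorem isIso_singularHomology_map_puncturedThreeTorusIncl_of_epi_toLocal
    (h : Epi (Literature.AlgebraicTopology.SingularHomology.singularHomology.toLocal ℤ ℤ (1 : ThreeTorus) 3)) :
    isIso_singularHomology_map_puncturedThreeTorusIncl := by
  refine ⟨isIso_singularHomology_map_puncturedThreeTorusIncl_one ℤ ℤ, ?_⟩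
  haveI := epi_singularHomology_map_puncturedThreeTorusIncl ℤ ℤ (k := 2) (by norm_num)
  haveI := mono_singularHomology_map_puncturedThreeTorusIncl_two_of_epi ℤ ℤ h
  exact isIso_of_mono_of_epi _

/-- **`isIso_singularHomology_map_puncturedThreeTorusIncl` from the orientability of `T³` and the
existence of fundamental classes** (Hatcher Thm. 3.26(a) for `T³`): the torus input (iii) of
`Literature.Topology.FourManifolds.isZero_singularHomology_two_mappingTorus_compl_sectionCircle_of_facts` reduced to the two
named facts `isOrientableOver_int_threeTorus` (specific to `T³`) and
`existsUnique_isFundamentalClass` (general, `…FundamentalClass`), everything else proved.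
[cite: HatcherAT2002, §3.3 Thm. 3.26] -/
theorem isIso_singularHomology_map_puncturedThreeTorusIncl_of_isOrientable
    (hO : isOrientableOver_int_threeTorus)
    (hF : @Literature.AlgebraicTopology.SingularHomology.existsUnique_isFundamentalClass ℤ _ ThreeTorus _ 3) :
    isIso_singularHomology_map_puncturedThreeTorusIncl := by
  haveI := isIso_toLocal_threeTorus_of_isOrientable hO hF 1
  exact isIso_singularHomology_map_puncturedThreeTorusIncl_of_epi_toLocal inferInstance

end Reduction

end Literature.Topology.FourManifolds
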